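import Mathlib
import HarnessLib
import HarnessLib.Audit
import Summits.PneNP.Statement
import Literature.Computability.Complexity.Classes
import Literature.Computability.Complexity.Nondeterministic
import Literature.Computability.Complexity.CNF
import Literature.Computability.MetaComplexity.ProofSystems
import Literature.Computability.MetaComplexity.Frege
import Summits.PneNP.PneNP.Theorems.ExpanderLinearGeneratorsTautBridge
import HarnessLib.Audit.Status.Attr

/-!
Route: ProofCplx

# Route PneNP/ProofCplx — "no propositional proof system is polynomially bounded" (logic / proof
complexity)

## Thesis X (it suffices to show)
Words: TAUT has no polynomially bounded Cook–Reckhow proof system (equivalently NP ≠ coNP,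
Cook–Reckhow 1979 Prop. 1.1).
Lean: `¬ Literature.Computability.MetaComplexity.HasPolyBoundedProofSystem
Literature.Computability.Complexity.TAUT`

## Assembly X → PneNP
Deciding theorem (D-0027 §2.1): `closes (hX : ProofcplxThesis) (hA : Assembly) : PneNP := hA hX`,
where the assembly item is the
frame `Assembly := ¬ HasPolyBoundedProofSystem TAUT → PneNP` (X → PneNP over vocabulary only; same
signature as stmt-PneNP-10249;
provable now: if P = NP then coNP = co P = P = NP (Arora–Barak 2009 §2.6.1), so TAUT ∈ NP has a
p-bounded proof system by Cook–Reckhow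
Prop. 1.4 — in tree `NP_eq_coNP_iff_hasPolyBoundedProofSystem_TAUT_holds` +
`Literature.CplxMeta.proofcplx_assembly` with the `_holds`
class facts, imported by the proving Theorems file, not by this route file). Second spine, logic
only: ProofcplxKrajicekGenerator → ProofcplxGeneratorImpliesNPNeCoNP →
ProofcplxNpNeCoNpBridge → PneNP. Route-repair 2026-08-15: the rev-2 Assembly (stmt-PneNP-0110, five
Literature named facts as
hypotheses — glue.extra-hypothesis) is restated as this frame; crux #4 is `EFNotPolyBounded`
UNFOLDED (Iff.rfl) so the route's
dependency cone is items + vocabulary only; imports reduced to Classes, Nondeterministic, CNF,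
MetaComplexity.ProofSystems,
MetaComplexity.Frege (ProofComplexity and ClayProblem dropped: they carried the open statements
EFNotPolyBounded / NPNotSubsetPPoly).

Rationale: WHY THIS LINE. Widen: mathematical logic — propositional proof complexity, bounded arithmetic,
forcing. Cook–Reckhow [CookReckhow1979, Prop. 1.1] turn P vs NP's shadow NP vs coNP into a uniform
lower-bound programme over proof systems, where genuine unconditional progress exists (Haken
[Haken1985], bounded-depth Frege [Ajtai1988, PitassiBeameImpagliazzo1993, KrajicekPudlakWoods1995]).
Krajíček's theory of proof complexity generators [arXiv:2208.11642, §1; KrajicekProofComplexity2019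
§19.4] isolates ONE typed conjecture — a p-time g : {0,1}^n → {0,1}^{n+1} whose range meets every
infinite NP set — that implies X for all proof systems at once, and imports model theory of bounded
arithmetic (KPT / student–teacher witnessing, forcing with random variables) and Kolmogorov
complexity as tools. The route is ranked generator-first because it is the only formulation of X
with a concrete candidate object (Krajíček's gadget generator).

RANKED CRUXES. #2 ProofcplxKrajicekGenerator — Krajíček's Conjecture 1.1: ∃ g ∈ FP, |g x| = |x|+1,
rng g meets every infinite NP language (why it might fail: uniform g hard for ALL proof systems is
far bolder than NP ≠ coNP; false for the truth-table generator unless NE ∩ coNE ⊆ P/poly; an i.o.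
FNP range-avoidance witness kills it; demi-bits support only the per-system form — arXiv:2208.11642
p.5, arXiv:2511.14061). #3 ProofcplxFregeNotPbounded — no Frege system is polynomially bounded (why
it might fail: Frege may be p-bounded; PHP and most combinatorial candidates have (quasi)poly-size
Frege proofs; only Ω(n²) known — Krajicek1995 Ch.13, Buss1987). #4 ProofcplxEfNotPbounded — no
extended Frege system is polynomially bounded, = Literature open statement EFNotPolyBounded
unfolded: ∀ F, IsFrege F → ¬ F.IsEFPolyBounded (why it might fail: EF = propositional PV/S¹₂ may be
p-bounded even if Frege is not; feasible interpolation fails for EF under RSA — KrajicekPudlak1998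
Cor. 10 = Barriers.FeasibleInterpolationEF; CookReckhow1979 §4). Logical position: #2 ⇒ NP ≠ coNP ⇔
X ⇒ #4 ⇒ #3 (rungs #3/#4 are NECESSARY for X, the recognised frontier; #2 is SUFFICIENT).

SUPPORT. #5 ProofcplxGeneratorImpliesNPNeCoNP (stmt-PneNP-0114): #2 → NP ≠ coNP (rng gᶜ is an
infinite coNP set missing rng g; elementary counting, ~100 lines). ProofcplxNpNeCoNpBridge
(stmt-PneNP-1046): NP ≠ coNP → PneNP (one line over Literature.CplxMeta.proofcplx_assembly and the
`_holds` class facts). Assembly (kind assembly, = stmt-PneNP-10249 by signature): X → PneNP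
(Cook–Reckhow easy direction + the previous; candidate proofs already attached to 10249). Deciding
theorem: closes hX hA := hA hX.

KILL CRITERIA. A polynomially bounded proof system for TAUT (¬X, i.e. NP = coNP) closes the route
outright. Refutation of #2 alone (every p-time n→n+1 map misses some infinite NP set) does NOT close
the route: pivot to #3/#4 with τ-tautologies of a specific map (Nisan–Wigderson generator) as the
hard family. If #3 is refuted (some Frege system p-bounded ⇒ NP = coNP by
NP_eq_coNP_of_isPolyBounded) the route dies together with X.

NOT DECOMPOSED YET. Choice of the generator g (gadget generator vs NW-generator vs random linear
maps); the bounded-arithmetic side (unprovability of dWPHP / circuit upper bounds in PV, S¹₂);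
AC⁰[p]-Frege as an intermediate rung; feasible interpolation / automatability links. These are
layer-2 children once #2, #3 or #4 moves (D-0019).

CHEAPEST FALSIFIER. For #2: exhibit, for the concrete gadget generator, an infinite NP set (even a
sparse one, {1ⁿ : n ∈ A}) provably disjoint from its range — or an FNP range-avoidance algorithm for
n→n+1 p-time maps infinitely often (cf. arXiv:2511.14061 Thm 1.1/1.5, which currently point the
other way only non-uniformly). For the whole line: any p-bounded proof system for TAUT (none is
expected; the lookup `ledger negatives --problem PneNP` shows no refuted statement of this route).

SOURCES. CookReckhow1979; Haken1985; arXiv:2208.11642; KrajicekProofComplexity2019; Krajicek1995;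
Buss1986; KrajicekPudlak1998; arXiv:2511.14061; arXiv:2312.08163; RazborovRudich1997;
AroraBarakCC2009 §2.6.1.

Novelty: NOVELTY (thesis level; searches run 2026-08-14: lit search --hybrid ×3, lit frontier PneNP --since
2020, lit bridges PneNP --cross any, lit read of the hits named below).
Nearest prior art — the line is Krajíček's theory of proof complexity generators, taken verbatim:
- Crux ProofcplxKrajicekGenerator IS Conjecture 1.1 of arXiv:2208.11642 (= Bull. Symb. Logic 30(1)
(2024) 20–40, p.4), originally Krajíček JSL 69 (2004) [ref 291 of KrajicekProofComplexity2019]; "g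
hard for all proof systems ⇔ rng(g) meets every infinite NP set" is KrajicekProofComplexity2019
Lemma 19.4.1 (p.420); "⇒ NP ≠ coNP ⇒ X" is Krajíček's own remark (2208.11642 p.4). The Frege/EF
rungs are Cook–Reckhow 1979 §2/§4 open problems (Krajicek1995 Ch.13; KrajicekProofComplexity2019
Problem 1.5.3, §22.3).
- In-programme: OPEN sibling route PneNP/proofcplx (route-PneNP-proofcplx; thesis NP ≠ coNP; cruxes
= Frege lb, EF lb, Frege-vs-EF separation) shares the Cook–Reckhow assembly and the Frege/EF rungs
(its stmt-PneNP-0043/0044 have the same signatures as 0112/0113 here).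
- Recent movement found: Ren–Wang–Zhong arXiv:2511.14061 (demi-bits ⇒ Avoid ∉ FNP, per-pps
non-uniform generators, k-round pseudo-surjectivity: Thm 1.1/1.3/1.5 — evidence for the WEAKER
per-system conjecture only; p.6: all-pps pseudo-surjectivity in the k ≥ s regime is impossible if E
⊄ SIZE[2^o(n)]); Ilango–Li–Williams STOC'23 and Chen–Li STOC'24 (Avoid hard from iO / LWE, cited
there); Pich–Santhanam arXiv:2312.08163 = doi:10.1145/3801091 (JACM  [refs: 10.1145/3801091, 2208.11642, 2511.14061, 2312.08163, doi:10.1145/3801091, KrajicekProofComplexity2019, Krajicek1995]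

Barriers (technique_class: proof-complexity-generators, bounded-arithmetic-witnessing): BARRIERS (catalogue Literature/Barriers/PneNP/*, decls in namespace Literature.Barriers.PneNP):
- FeasibleInterpolationEF (KrajicekPudlak1998 Cor. 10; technique class feasible-interpolation):
APPLIES to rungs ProofcplxEfNotPbounded/ProofcplxFregeNotPbounded — under RSAPairInseparable no
Frege rule set has feasible interpolation for EF (and, per Segerlind2007 §5, one-way functions kill
it for Frege), so the one general method that turns computational hardness into proof-size lower
bounds is unavailable at these rungs. Not evaded: no replacement method is named; Krajíček positions
Conj. 1.1 precisely as the all-proof-systems substitute for feasible interpolation ("a reduction of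
provability hardness to computational hardness for all proof systems", arXiv:2208.11642 p.4) — that
is the bet, not an evasion.
- NaturalProofs (RazborovRudich1997 Thm 4.1) and NaturalProofsTC0: stated for large+constructive
properties against P/poly resp. TC⁰ circuits; they do NOT formally apply to proof-size lower bounds
(no largeness condition is known to be forced on them — the reason the sibling route gives for
staffing Frege/EF at all). But a cousin obstruction bites the choice of g: the truth-table generator
cannot be hard for all proof systems unless NE ∩ coNE ⊆ P/poly (arXiv:2208.11642 p.5;
KrajicekProofComplexity2019 p.426), and Rudich's demi-bits (ref [454] there; arXiv:2511.14061)
govern which stretching maps can have NP-immune co-range. Evasion claimed by the source: use the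
gadget generato

Novelty grade: known — known (refuter route-review grade, 2026-08-15). Nearest prior art IS the route: thesis X + rungs #3 (Frege) / #4 (EF) = the Cook–Reckhow 1979 programme as printed (Krajicek2019 Problem 1.5.3; Krajicek1995 p.236); crux #2 = Krajíček's Conjecture 1.1 verbatim (2208.11642 p.4, re-read), including its p (refuter refuter-rreview1-PneNP-ProofCplx-8506c399-0, 2026-08-15T18:25:21Z; prior: arXiv:2208.11642 Conj. 1.1 p.4 (= Bull. Symb. Logic 30(1) 2024) — crux #2 verbatim, Krajíček JSL 69 (2004) [Kra-dual] — origin of the all-pps generator conjecture, KrajicekProofComplexity2019 Lemma 19.4.1 p.420, Problem 1.5.3 p.44, §22.2-22.3 pp.468-471, CookReckhow1979 §1 Prop. 1.1/1.4, §2, §4 — thesis X, rungs #3/#4, assembly, Krajicek1995 Ch.13 p.236/242, Def 4.5.2 p.53, arXiv:2511.14061 (Ren–W)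

History (route lifecycle, newest last):
- 2026-08-15T16:24:27Z · rev 3: restated ProofcplxEfNotPbounded (stmt-PneNP-0113) — route-repair (cone guardrail): crux #4 restated as EFNotPolyBounded UNFOLDED — definitionally equal (Iff.rfl, SketchIff.lean rc0), meaning unchanged, still impl (planner-rbadge-PneNP-ProofCplx-8506c399-g2-0)
- 2026-08-15T16:29:08Z · rev 4: restated Assembly (stmt-PneNP-0110) — route-repair (glue.extra-hypothesis + cone guardrail): Assembly restated as the frame X → PneNP over vocabulary only (= signature of stmt-PneNP-10249, provable (planner-rbadge-PneNP-ProofCplx-8506c399-g2-0)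
- 2026-08-16T04:14:37Z · AUTO-CRUX (backfill): ProofcplxThesis — hypotheses of the deciding theorem that nothing in the route derives are cruxes (operator:999:1085951)
- 2026-08-23T06:21:53Z · DORMANT — reconciler: no traction for 5.9 d (last activity statement-grounded at 2026-08-17T07:03:06Z); parked, not closed — `ledger route dormant route-PneNP-ProofCplx - (operator:999:3183452)
- 2026-08-31T18:09:47Z · REACTIVATED (open) — reconciler: reactivated — activity statement-checked at 2026-08-31T17:28:55Z after parking at 2026-08-23T06:21:53Z (operator:999:1801627)

sub-problem: PneNP · status: open · opened planner-PneNP-Survey-0 2026-08-13T06:05:37Z · rev 5 · ledger route-PneNP-ProofCplx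
GENERATED by the gate from the ledger (D-0016/17). Provers cite these decls: `theorem foo : Summit.PneNP.PneNP.Theses.ProofCplx.<Decl> := …` in Summits/PneNP/PneNP/Theorems/<Name>.lean.
-/

namespace Summit.PneNP.PneNP.Theses.ProofCplx

open scoped BigOperators Topology Manifold Classical MeasureTheory ProbabilityTheory Matrix InnerProductSpace ComplexConjugate ContinuousMap
open Filter Set Function TopologicalSpace MeasureTheory

attribute [summit_statement] _root_.PneNP

open Literature.PNP

/-- item stmt-PneNP-0097 · crux (kind.auto-crux: conjecture-grade) · rank 0 · open · by planner
why it might fail: X ⇔ NP≠coNP (Cook–Reckhow): false iff SOME pps, however unnatural, is p-bounded. No superpolynomial size lower bound is known for any system from Frege up (Krajíček 1995 Ch.13: 'no nontrivial lower bounds'; 2019 Problem 1.5.3 open); X ⇒ P≠NP, so relativization/algebrization constrain any proof.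
sources: CookReckhow1979 §1 Prop 1.1 (fact Literature.Computability.Complexity.NP_eq_coNP_iff_hasPolyBoundedProofSystem_TAUT), KrajicekProofComplexity2019 Problem 1.5.3 (p.44), §22.3 (pp.468-470), Krajicek1995 Ch.13 intro (pdf p.236), Literature.Barriers.PneNP.Relativization, Literature.Barriers.PneNP.Algebrization
No Cook–Reckhow proof system for TAUT is polynomially bounded; equivalently NP ≠ coNP
[CookReckhow1979, Prop. 1.1]. Route thesis of PneNP/ProofCplx. [sources: CookReckhow1979;
arXiv:2208.11642] -/
@[route_item "route-PneNP-ProofCplx", crux]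
def ProofcplxThesis : Prop :=
  ¬ Literature.Computability.MetaComplexity.HasPolyBoundedProofSystem Literature.Computability.Complexity.TAUT

/-- item stmt-PneNP-0111 · crux · rank 2 · open · by planner
why it might fail: Uniform g hard for ALL pps is far bolder than NP≠coNP: false if NP=coNP; false for natural g (truth-table generator is not all-pps-hard unless NE∩coNE⊆P/poly, 2208.11642 p.5); an i.o. FNP range-avoidance witness for the chosen g kills it; demi-bits back only the weaker per-pps form (2511.14061).
sources: arXiv:2208.11642 Conj. 1.1 (p.4), p.5 (truth-table generator caveat), §2 pp.6-7 (witnessing dWPHP = range avoidance) [= Bull. Symb. Logic 30(1) (2024) 20-40], KrajicekProofComplexity2019 Lemma 19.4.1 (p.420), p.426, notes p.431 (Rudich demi-bits, ref [454]); ref [291] = Krajíček JSL 69 (2004) [Kra-dual], arXiv:2511.14061 Thm 1.1, 1.3, 1.5 and p.5-6 (Ren–Wang–Zhong 2025: evidence for the WEAKER conjecture only; all-pps pseudo-surjectivity blocked if E ⊄ SIZE[2^o(n)])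
Krajíček (2004; arXiv:2208.11642 §1, displayed conjecture): there is a polynomial-time g stretching
each input by one bit whose range intersects every infinite NP language. Equivalent to the existence
of a proof complexity generator hard for ALL proof systems; implies NP ≠ coNP (the complement of
range g is an infinite coNP set with no infinite NP subset). Hardest and most informative crux: it
names a candidate object (gadget generator). [sources: arXiv:2208.11642] [route PneNP/ProofCplx,
rank 2] -/
@[route_item "route-PneNP-ProofCplx", crux]
def ProofcplxKrajicekGenerator : Prop :=
  ∃ g : List Bool → List Bool, g ∈ Literature.Computability.Complexity.FP ∧ (∀ x, (g x).length = x.length + 1) ∧ ∀ L ∈ Literature.Computability.Complexity.Nondeterministic.NP, L.Infinite → ∃ x, g x ∈ L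

/-- item stmt-PneNP-0112 · crux · rank 3 · open · by planner
why it might fail: Frege may be p-bounded: PHP has poly-size and most combinatorial candidates quasi-poly-size F-proofs (Buss 1987; Krajíček 1995 §13.1); 'no nontrivial lower bounds are known' beyond Lemma 4.4.12-type bounds (1995 Ch.13 intro; still so, 2019 §22.2); no method is known to reach unbounded depth.
sources: Krajicek1995 Ch.13 intro (pdf p.236) + §13.1, Lemma 4.4.12, KrajicekProofComplexity2019 §22.2 p.468 (only reduction proposals: MullerPich2020 Prop 4.14; Filmus–Pitassi–Santhanam doi:10.1145/2656209), CookReckhow1979 §2 (facts Literature.Computability.Complexity.frege_pSimulates, isPolyBounded_iff_of_isFrege), Literature.Computability.MetaComplexity.isFrege_textbookFrege (IsFrege inhabited only via this fact — refuter flag, not a vacuity exploit)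
Superpolynomial Frege lower bounds for some family of tautologies (open since Cook–Reckhow 1979 §2;
Krajíček 1995 §4.4). Necessary for the thesis; the recognised frontier above bounded-depth Frege.
[sources: CookReckhow1979; Buss1999] [route PneNP/ProofCplx, rank 3] -/
@[route_item "route-PneNP-ProofCplx"]
def ProofcplxFregeNotPbounded : Prop :=
  ∀ F : Literature.Computability.MetaComplexity.FregeSystem, Literature.Computability.MetaComplexity.IsFrege F → ¬ F.IsPolyBounded

-- earlier ProofcplxEfNotPbounded (stmt-PneNP-0113, replaced 2026-08-15T16:24:27Z -> stmt-PneNP-10743): retired by None — Literature.Computability.Complexity.EFNotPolyBounded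
/-- item stmt-PneNP-10743 · crux · rank 4 · open · by planner
why it might fail: EF (= propositional PV/S¹₂, formalising most known complexity theory: Krajíček 2019 §22.3) may be p-bounded even if Frege is not; no superlinear EF lower bound on any family; feasible interpolation fails for EF under RSA (Krajíček–Pudlák 1998 Cor. 10 = Barriers.FeasibleInterpolationEF).
sources: CookReckhow1979 §4 (EF; conjecture after Prop. 1.4) — unfolded form of Literature.Computability.Complexity.EFNotPolyBounded (Iff.rfl); efNotPolyBounded_iff_textbookFrege_holds, KrajicekPudlak1998 Cor. 10 (Literature.Barriers.PneNP.FeasibleInterpolationEF), KrajicekProofComplexity2019 Problem 1.5.3, §22.3 pp.468-470, arXiv:2312.08163 = doi:10.1145/3801091 (Pich–Santhanam: EF lower bounds + S¹₂-provable hypotheses ⇒ P ≠ NP)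
[crux] pnp.S32 stated directly: for every Frege system F (finitely many sound rules, implicationally
complete), extended Frege over F is not polynomially bounded — no polynomial p gives every tautology
φ an EF-proof of symbol size ≤ p(φ.size). This is verbatim the definiens of the Literature open
statement `Literature.Computability.Complexity.EFNotPolyBounded` (ProofComplexity.lean; the item is
`Iff.rfl`-equal to it, so theorem `not_isPolyBounded_of_efNotPolyBounded` (#3 → #2) and fact
`efNotPolyBounded_iff_textbookFrege` (reduce to textbookFrege) transfer by `Iff.rfl`); restated
inline (route-repair 2026-08-15) so that the route's cone carries the open conjecture as a ROUTE
ITEM and not as an undischarged Literature Prop (D-0023 staffability; conjectures live in routes).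
Open (CookReckhow1979 §4). Equivalent to unprovability of NP = coNP-type statements in S¹₂/PV via
propositional translation (Cook 1975; Buss1998) — where bounded arithmetic / forcing enters.
Grounder/refuter verdicts on the replaced item stmt-PneNP-0044 (NEW/OPEN, 2026-08-13) apply
unchanged. [deps: ProofcplxFregeLb] [difficulty: open-problem] -/
@[route_item "route-PneNP-ProofCplx"]
def ProofcplxEfNotPbounded : Prop :=
  ∀ F : Literature.Computability.MetaComplexity.FregeSystem, Literature.Computability.MetaComplexity.IsFrege F → ¬ F.IsEFPolyBounded

/-- item stmt-PneNP-0114 · support · rank 5 · closed · proved by Summit.PneNP.PneNP.Theorems.proofcplx_generatorImpliesNPNeCoNP_proof @ c935a14e6d05 (prover) · by planner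
sources: arXiv:2208.11642 §1 (p.4), KrajicekProofComplexity2019 Lemma 19.4.1 (p.420)
Elementary: range(g)ᶜ is in coNP (g ∈ FP, |g x| = |x|+1 so preimages have length |y|-1) and is
infinite by counting (2^n inputs vs 2^{n+1} strings of length n+1); if NP = coNP it would be an
infinite NP set disjoint from range g. Validates that crux #2 sits above the thesis. May need the
fact that FP functions have p-time graph (CplxCore). [sources: arXiv:2208.11642] [route
PneNP/ProofCplx, rank 5] -/
@[route_item "route-PneNP-ProofCplx"]
def ProofcplxGeneratorImpliesNPNeCoNP : Prop :=
  (∃ g : List Bool → List Bool, g ∈ Literature.Computability.Complexity.FP ∧ (∀ x, (g x).length = x.length + 1) ∧ ∀ L ∈ Literature.Computability.Complexity.Nondeterministic.NP, L.Infinite → ∃ x, g x ∈ L) → Literature.Computability.Complexity.Nondeterministic.NP ≠ Literature.Computability.Complexity.coNP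

-- `ProofcplxGeneratorImpliesNPNeCoNP` holds: proved by `Summit.PneNP.PneNP.Theorems.proofcplx_generatorImpliesNPNeCoNP_proof` @ c935a14e6d05 (its module imports this route file, so no `_holds` link can be stated here).

/-- item stmt-PneNP-1046 · support · rank 9 · closed · proved by Summit.PneNP.PneNP.Theorems.proofcplx_npNeCoNpBridge_proof @ 0aaa10920304 (prover) · by planner
[support] Model bridge NP ≠ coNP → PneNP (Cook's Clay statement over Mathlib TM2; Arora–Barak 2009
§2.6.1: if P = NP then coNP = co P = P = NP). PROVABLE NOW in one line:
`Literature.CplxMeta.proofcplx_assembly P_subset_NP_holds P_bool_eq_holds NP_bool_eq_holds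
co_P_holds` (imports Summits.PneNP.PneNP.Theorems.ProofCplxAssembly,
Literature.Computability.Complexity.ClayProblemProofs, .NondeterministicProofs; planner
SketchCheck.lean rc 0, axioms propext/Classical.choice/Quot.sound — attached as evidence). PURPOSE
(route-repair 2026-08-15, cone guardrail): lets the Assembly be restated as `TAUT_mem_coNP → (∀ L,
@hasPolyBoundedProofSystem_iff_mem_NP L) → ProofcplxNpNeCoNpBridge → X → PneNP` so that the ROUTE
FILE no longer needs to import Literature.Computability.Complexity.ClayProblem (home of the
registered open conjecture NPNotSubsetPPoly, counted as an unproved cone fact) nor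
…Complexity.ProofComplexity; a Theorems file may import freely. [sources: AroraBarakCC2009 §2.6.1;
CookClay2006 §1; in-tree Literature.CplxMeta.proofcplx_assembly] -/
@[route_item "route-PneNP-ProofCplx"]
def ProofcplxNpNeCoNpBridge : Prop :=
  Literature.Computability.Complexity.Nondeterministic.NP ≠ Literature.Computability.Complexity.coNP → PneNP

-- `ProofcplxNpNeCoNpBridge` holds: proved by `Summit.PneNP.PneNP.Theorems.proofcplx_npNeCoNpBridge_proof` @ 0aaa10920304 (its module imports this route file, so no `_holds` link can be stated here).

-- earlier Assembly (stmt-PneNP-0110, replaced 2026-08-15T16:29:08Z -> stmt-PneNP-10249): retired by None — Literature.Computability.Complexity.NP_eq_coNP_iff_hasPolyBoundedProofSystem_TAUT → Literature.Computability.Complexity.co_P → Literature.Computability.Complexity.P_bool_eq → Literature.Computability.Complexity.NP_bool_eq → Literature.Computability.Complexity.P_subset_NP → ¬ Literature.Computab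
/-- item stmt-PneNP-10249 · assembly · rank 1 · closed · proved by Summit.PneNP.PneNP.Theorems.tautBridge_proof @ d852aa9184c8 (prover) · by planner
sources: CookReckhow1979 §1 Prop. 1.1, 1.4 (Literature.Computability.Complexity.NP_eq_coNP_iff_hasPolyBoundedProofSystem_TAUT_holds), AroraBarakCC2009 §2.6.1 (Literature.CplxMeta.proofcplx_assembly, Summits/PneNP/PneNP/Theorems/ProofCplxAssembly.lean)
[support] X → PneNP over the tree's classes: if P = NP then coNP = co P = P ⊆ NP, so TAUT ∈ NP has a
p-bounded proof system (Cook–Reckhow general form). Provable now from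
hasPolyBoundedProofSystem_iff_mem_NP_holds, TAUT_mem_coNP_holds, co_P_holds, P_bool_eq_holds,
NP_bool_eq_holds, P_subset_NP_holds (cf. Literature.CplxMeta.proofcplx_assembly). [difficulty:
provable-now] -/
@[route_item "route-PneNP-ProofCplx", crux]
def Assembly : Prop :=
  ¬ Literature.Computability.MetaComplexity.HasPolyBoundedProofSystem Literature.Computability.Complexity.TAUT → PneNP

/-- `Assembly` holds: proved by `Summit.PneNP.PneNP.Theorems.tautBridge_proof` @ d852aa9184c8. -/
theorem Assembly_holds : Assembly := _root_.Summit.PneNP.PneNP.Theorems.tautBridge_proof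

/-! D-0027 §2.1 — DECIDING THEOREM (planner-authored via `route open/edit --closes-file`; by planner-rbadge-PneNP-ProofCplx-8506c399-g2-0 2026-08-15T16:30:14Z):
its hypotheses are this route's items and its conclusion the sub-problem Statement (glue_lint), and it elaborates with this file. -/

@[closes "route-PneNP-ProofCplx"] theorem closes (hX : ProofcplxThesis) (hA : Assembly) : PneNP := hA hX

end Summit.PneNP.PneNP.Theses.ProofCplx
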